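import Literature.AlgebraicGeometry.Resolution.WeightedCentreTailedLightFlow
import Literature.AlgebraicGeometry.Resolution.WeightedCentreKillCoordinates
import HarnessLib

/-!
# Step (L0′) of engine 1's `W(f)` toy model: the lowest moved light class of a tailed light flow with CONSTANT datum is killed
# (RE-DERIVATION-eng1-g44 §3.2 (L0′)/(L7) — an instrument for the toy model, NOT a resolution theorem)

RE-DERIVATION-eng1-g44 §3.2, step (L0′) of the proof of THEOREM 𝔉′: let `(𝔇, q)` be a tailed light flow of unit `θ`
(`WeightedCentreTailedLightFlow`, structure `IsTailedLightFlow`) and let `Y` be the LOWEST moved light class; if the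
datum on a slot `y ∈ Y` is a nonzero CONSTANT `𝔇(ε_y) = c` (forced when `Y = L₁`, or in general once everything below `Y` is known to be
fixed), then LEMMA L7 (`WeightedCentreKillCoordinates`: "no pure light translation", generalised) produces a GRADED unipotent
coordinate change `Λ` with `Λ⁻¹ h = h|_{ε_y = 0}` — so `h` is free of the class-`Y` coordinate `Λ⁻¹ ε_y` and the slot direction
`e_y` is an invariant direction of `Λ⁻¹ h`: hypothesis (P) FAILS at the light class `Y` (of weight `w_Y = θ > η`) in these
coordinates.  This file is the LINK between the two instruments: it discharges the hypotheses `h0 / htri / hmove / hφw / hy / hh`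
of `KillCoordinates.killEquiv` from the fields of `IsTailedLightFlow` plus "`Y` is the lowest moved class", using the refined
rank `killRank w y i = 2·#{l : w l < w i} + [w i = w y ∧ i ≠ y]` (no basis change inside the class `Y` is needed: the other
slots of `Y` are ranked just above `y`).

Main results (all DERIVED HERE; `k` a field, `ι` finite, `u_b · b! = 1` for `b < p`, `1 < p`):
* `substC_X_of_apply_eq_C` : `𝔇(ε_y) = c`, `q_y = 0` ⟹ `Φ(T)(ε_y) = ε_y + cT`;
* `IsTailedLightFlow.weight_eq_of_apply_eq_C` : a nonzero constant datum on `ε_y` forces `w y = θ`;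
* `IsTailedLightFlow.killRank_lt` : the triangularity hypothesis `hrk` of `killEquiv` for `φ = Φ(T)`, `rk = killRank w y`,
  from "`𝔇 = 0` on the slots of weight `< w y`";
* `IsTailedLightFlow.notMem_vars_kill` / `isInvariantDir_kill` / `not_classPinned_kill` : in the kill coordinates `h` does not
  involve `ε_y`, `e_y` is an invariant direction, and `h` is NOT class-pinned at `y` for any class `S ∋ y`;
* `IsTailedLightFlow.isWeightedHomogeneous_kill` : `Λ`, `Λ⁻¹` are graded; `IsTailedLightFlow.kill_X_of_dataFree` : `Λ` fixes
  every data-free slot (`𝔇(ε_i) = 0 = q_i`; in particular the `V`-type slots and the light slots below `Y`).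

HONEST FRAMING.  Commutative algebra over a field; an instrument for engine 1's `W(f)` TOY MODEL (one step of the engine's proof
plan for THEOREM 𝔉′, whose typed target is `TailedLightFlow.NoTailedLightFlow` and which is NOT proved here).  It is NOT a
resolution theorem and says nothing about the invariant of [ATW2024]; [Matsumura1987, §27, §25] (Hasse–Schmidt derivations,
derivations of polynomial rings), [Lang2002, Ch. IV §1] (substitution homomorphisms) and [ATW2024, Thm. 5.3.1] are cited for
context only.
-/

namespace Literature.AlgebraicGeometry.Resolution.WeightedBlowup

open Polynomial
open scoped Nat

namespace TailedLightFlow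

/-! ## The refined rank -/

section Rank

variable {ι : Type*} [Fintype ι] [DecidableEq ι] {N : Type*} [LinearOrder N] (w : ι → N) (y : ι)

/-- The refined rank `killRank w y i = 2·#{l : w l < w i} + [w i = w y ∧ i ≠ y]`: it refines the weight order and puts `y`
strictly below the other slots of its own weight (this file). [cite: Lang2002, Ch. IV §1] -/
def killRank (i : ι) : ℕ := 2 * (Finset.univ.filter fun l => w l < w i).card + if w i = w y ∧ i ≠ y then 1 else 0

/-- `w j < w i ⟹ killRank j < killRank i` (derived here). [cite: Lang2002, Ch. IV §1] -/
theorem killRank_lt_of_lt {i j : ι} (h : w j < w i) : killRank w y j < killRank w y i := by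
  have h1 := KillCoordinates.card_filter_lt_lt_of_lt w h
  unfold killRank
  split_ifs <;> omega

/-- `w i = w y`, `i ≠ y ⟹ killRank y < killRank i` (derived here). [cite: Lang2002, Ch. IV §1] -/
theorem killRank_lt_of_eq {i : ι} (h : w i = w y) (hi : i ≠ y) : killRank w y y < killRank w y i := by
  unfold killRank
  have h1 : (Finset.univ.filter fun l => w l < w y) = Finset.univ.filter fun l => w l < w i := by rw [h]
  rw [h1, if_neg (show ¬(w y = w y ∧ y ≠ y) from fun h' => h'.2 rfl), if_pos (show w i = w y ∧ i ≠ y from ⟨h, hi⟩)]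
  omega

end Rank

/-! ## `Φ(T)(ε_y) = ε_y + cT` for a constant datum -/

section Constant

variable {k : Type*} [CommRing k] {ι : Type*} (D : Derivation k (MvPolynomial ι k) (MvPolynomial ι k)) (p : ℕ) (u : ℕ → k)
  (q : ι → MvPolynomial ι k)

/-- `𝔇^n(c) = 0` for a constant `c` and `n ≥ 1` (derived here). [cite: Matsumura1987, §25] -/
theorem iterate_C_eq_zero (c : k) {n : ℕ} (hn : 0 < n) : D^[n] (MvPolynomial.C c) = 0 := by
  obtain ⟨m, rfl⟩ := Nat.exists_eq_add_of_lt hn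
  rw [Nat.zero_add, Function.iterate_add_apply, Function.iterate_one, ← MvPolynomial.algebraMap_eq, D.map_algebraMap]
  clear hn
  induction m with
  | zero => rfl
  | succ m ih => rw [Function.iterate_succ_apply', ih, map_zero]

/-- **`Φ(T)(ε_y) = ε_y + cT`** when `𝔇(ε_y) = c` is a constant and `q_y = 0` (`u_0 = u_1 = 1`, `1 < p`; derived here).
[cite: Matsumura1987, §27 (pp. 207–209)] -/
theorem substC_X_of_apply_eq_C (hu : ∀ n < p, ((n ! : ℕ) : k) * u n = 1) (hp : 1 < p) {y : ι} {c : k}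
    (hy : D (MvPolynomial.X y) = MvPolynomial.C c) (hq : q y = 0) :
    substC D p u q (MvPolynomial.X y) = C (MvPolynomial.X y) + C (MvPolynomial.C c) * X := by
  ext n
  rw [Polynomial.coeff_add, Polynomial.coeff_C_mul, Polynomial.coeff_C, Polynomial.coeff_X]
  rcases Nat.lt_trichotomy n 1 with h0 | rfl | h2
  · obtain rfl : n = 0 := by omega
    rw [coeff_substC_X_zero D p u q hu (by omega), if_pos rfl, if_neg one_ne_zero, mul_zero, add_zero]
  · rw [coeff_substC_X_one D p u q hu hp, hy, if_neg one_ne_zero, if_pos rfl, mul_one, zero_add]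
  · rw [if_neg (show n ≠ 0 by omega), if_neg (show 1 ≠ n by omega), mul_zero, add_zero, coeff_substC_X, hq, ite_self,
      add_zero]
    obtain ⟨m, rfl⟩ := Nat.exists_eq_add_of_lt h2
    rw [show 1 + m + 1 = (m + 1) + 1 by ring, Function.iterate_succ_apply, hy, iterate_C_eq_zero D c (Nat.succ_pos m),
      smul_zero, ite_self]

end Constant

/-! ## The link: a tailed light flow with a constant datum on its lowest moved class feeds `KillCoordinates` -/

section Lowest

variable {k : Type*} [Field k] {ι : Type*} [Fintype ι] [DecidableEq ι] {p : ℕ} {u : ℕ → k} {w : ι → ℚ} {θ : ℚ}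
  {h : MvPolynomial ι k} {D : Derivation k (MvPolynomial ι k) (MvPolynomial ι k)} {q : ι → MvPolynomial ι k}

namespace IsTailedLightFlow

omit [Fintype ι] [DecidableEq ι] in
/-- A nonzero CONSTANT datum `𝔇(ε_y) = c ≠ 0` forces `w y = θ`: the class of `y` has weight exactly the unit (derived here).
[cite: AbramovichTemkinWlodarczyk2024, Thm. 5.3.1 (2)-(3) (p. 1578)] -/
theorem weight_eq_of_apply_eq_C (F : IsTailedLightFlow p u w θ h D q) {y : ι} {c : k} (hc : c ≠ 0)
    (hy : D (MvPolynomial.X y) = MvPolynomial.C c) : w y = θ := by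
  have h1 : MvPolynomial.IsWeightedHomogeneous w (MvPolynomial.C c : MvPolynomial ι k) (w y - θ) := hy ▸ F.wt_D y
  have hne : (MvPolynomial.C c : MvPolynomial ι k) ≠ 0 := by rwa [Ne, MvPolynomial.C_eq_zero]
  exact sub_eq_zero.mp (h1.inj_right hne (MvPolynomial.isWeightedHomogeneous_C w c))

omit [Fintype ι] [DecidableEq ι] in
/-- The `T`-coefficients of `Φ(T)(ε_i)` have weights `w i - n • w y` once `w y = θ` (derived here).
[cite: AbramovichTemkinWlodarczyk2024, Thm. 5.3.1 (2)-(3) (p. 1578)] -/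
theorem isWeightedHomogeneous_coeff (F : IsTailedLightFlow p u w θ h D q) {y : ι} (hθ : w y = θ) (i : ι) (n : ℕ) :
    MvPolynomial.IsWeightedHomogeneous w ((substC D p u q (MvPolynomial.X i)).coeff n) (w i - n • w y) := by
  rw [hθ]; exact isTW_substC_X D p u F.wt_D (F.wt_q i) n

/-- **The triangularity hypothesis `hrk` of `killEquiv`** for `φ = Φ(T)`, `rk = killRank w y`, when `y` is light and every
slot of weight `< w y` is `𝔇`-free ("`Y` is the lowest moved light class"; derived here). [cite: Lang2002, Ch. IV §1] -/
theorem killRank_lt (F : IsTailedLightFlow p u w θ h D q) (hu : ∀ n < p, ((n ! : ℕ) : k) * u n = 1) (hp : 1 < p) {y : ι} (c : k)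
    (hwy : w y < p) (hlow : ∀ i, w i < w y → D (MvPolynomial.X i) = 0) :
    ∀ i, ∀ j ∈ (KillCoordinates.killSubst (substC D p u q) y c i - MvPolynomial.X i).vars, killRank w y j < killRank w y i := by
  refine KillCoordinates.rk_lt_of_mem_vars_killSubst_sub (substC D p u q) y c (killRank w y)
    (coeff_substC_X_zero D p u q hu (by omega)) (fun i n hn j hj => killRank_lt_of_lt w y (F.vars_coeff_substC_X i hn j hj).2)
    fun i hiy hex => ?_
  obtain ⟨n, hn, hne⟩ := hex
  rcases lt_trichotomy (w i) (w y) with hlt | heq | hgt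
  · exfalso
    apply hne
    rw [substC_X_eq_C D p u q hu (by omega) (hlow i hlt) (F.q_eq_zero_of_light (lt_trans hlt hwy)), Polynomial.coeff_C,
      if_neg (by omega)]
  · exact killRank_lt_of_eq w y heq hiy
  · exact killRank_lt_of_lt w y hgt

/-- The kill coordinates `Λ` of step (L0′) (this file): `KillCoordinates.killEquiv` for `φ = Φ(T)`, `rk = killRank w y`.
[cite: Lang2002, Ch. IV §1] -/
noncomputable def kill (F : IsTailedLightFlow p u w θ h D q) (hu : ∀ n < p, ((n ! : ℕ) : k) * u n = 1) (hp : 1 < p) (y : ι)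
    (c : k) (hwy : w y < p) (hlow : ∀ i, w i < w y → D (MvPolynomial.X i) = 0) :
    MvPolynomial ι k ≃ₐ[k] MvPolynomial ι k :=
  KillCoordinates.killEquiv (substC D p u q) y c (killRank w y) (F.killRank_lt hu hp c hwy hlow)

variable (F : IsTailedLightFlow p u w θ h D q) (hu : ∀ n < p, ((n ! : ℕ) : k) * u n = 1) (hp : 1 < p) {y : ι} {c : k}
  (hc : c ≠ 0) (hy : D (MvPolynomial.X y) = MvPolynomial.C c) (hwy : w y < p) (hlow : ∀ i, w i < w y → D (MvPolynomial.X i) = 0)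

/-- `Λ ε_i = Π″(ε_i)` = the `T`-constant term of `Φ(-ε_y/c)(ε_i)` (derived here). [cite: Lang2002, Ch. IV §1] -/
theorem kill_X (i : ι) :
    F.kill hu hp y c hwy hlow (MvPolynomial.X i) = KillCoordinates.killSubst (substC D p u q) y c i :=
  KillCoordinates.killEquiv_X _ y c _ _ i

/-- `Λ` FIXES every data-free slot (`𝔇(ε_i) = 0 = q_i`): the `V`-type slots, the light slots below `Y`, … (derived here).
[cite: Lang2002, Ch. IV §1] -/
theorem kill_X_of_dataFree {i : ι} (hD : D (MvPolynomial.X i) = 0) (hq : q i = 0) :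
    F.kill hu hp y c hwy hlow (MvPolynomial.X i) = MvPolynomial.X i :=
  KillCoordinates.killEquiv_X_of_map_X _ y c _ _ (substC_X_eq_C D p u q hu (by omega) hD hq)

/-- `Λ` fixes the light slots below `Y` (derived here). [cite: Lang2002, Ch. IV §1] -/
theorem kill_X_of_lt {i : ι} (hi : w i < w y) : F.kill hu hp y c hwy hlow (MvPolynomial.X i) = MvPolynomial.X i :=
  F.kill_X_of_dataFree hu hp hwy hlow (hlow i hi) (F.q_eq_zero_of_light (lt_trans hi hwy))

/-- `Λ` fixes the `V`-type slots (derived here). [cite: AbramovichTemkinWlodarczyk2024, Thm. 5.3.1 (2)-(3) (p. 1578)] -/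
theorem kill_X_of_V {i : ι} (hi : (p : ℚ) + 1 < w i) : F.kill hu hp y c hwy hlow (MvPolynomial.X i) = MvPolynomial.X i :=
  F.kill_X_of_dataFree hu hp hwy hlow (F.D_X_eq_zero i hi) (F.q_eq_zero i (Or.inr hi))

include hc hy in
/-- **`Λ`, `Λ⁻¹` are GRADED** (derived here): the kill coordinates are a graded coordinate system.
[cite: AbramovichTemkinWlodarczyk2024, Lemma 5.2.10 (p. 1577)] -/
theorem isWeightedHomogeneous_kill {P : MvPolynomial ι k} {m : ℚ} (hP : MvPolynomial.IsWeightedHomogeneous w P m) :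
    MvPolynomial.IsWeightedHomogeneous w (F.kill hu hp y c hwy hlow P) m ∧
      MvPolynomial.IsWeightedHomogeneous w ((F.kill hu hp y c hwy hlow).symm P) m :=
  KillCoordinates.isWeightedHomogeneous_killEquiv _ y c _ _ w (F.isWeightedHomogeneous_coeff (F.weight_eq_of_apply_eq_C hc hy)) hP

include hc hy in
/-- **`Λ⁻¹ h = h|_{ε_y = 0}`** (derived here). [cite: Lang2002, Ch. IV §1] -/
theorem kill_symm_apply : (F.kill hu hp y c hwy hlow).symm h = ParameterKill.kill y h :=
  KillCoordinates.symm_apply_eq_kill _ y c _ _ hc (substC_X_of_apply_eq_C D p u q hu hp hy (F.q_eq_zero_of_light hwy)) F.fix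

include hc hy in
/-- **In the kill coordinates `h` does not involve `ε_y`** (derived here). [cite: Lang2002, Ch. IV §1] -/
theorem notMem_vars_kill : y ∉ ((F.kill hu hp y c hwy hlow).symm h).vars :=
  KillCoordinates.notMem_vars_symm_apply _ y c _ _ hc (substC_X_of_apply_eq_C D p u q hu hp hy (F.q_eq_zero_of_light hwy)) F.fix

include hc hy in
/-- **`e_y` is an invariant direction of `Λ⁻¹ h`** (derived here). [cite: Matsumura1987, §27 (p. 207)] -/
theorem isInvariantDir_kill : InvariantDirection.IsInvariantDir ((F.kill hu hp y c hwy hlow).symm h) (Pi.single y 1) :=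
  KillCoordinates.isInvariantDir_symm_apply _ y c _ _ hc (substC_X_of_apply_eq_C D p u q hu hp hy (F.q_eq_zero_of_light hwy))
    F.fix

include hc hy in
/-- **Step (L0′): hypothesis (P) FAILS at the class of `y` in the kill coordinates** — `Λ⁻¹ h` is not class-pinned at `y` for
any class `S ∋ y` (derived here).
[cite: Matsumura1987, §27 (p. 207)] [cite: AbramovichTemkinWlodarczyk2024, Thm. 5.3.1 (2)-(3) (p. 1578)] -/
theorem not_classPinned_kill {S : Finset ι} (hyS : y ∈ S) :
    ¬ InvariantDirection.ClassPinned S ((F.kill hu hp y c hwy hlow).symm h) y :=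
  KillCoordinates.not_classPinned_symm_apply _ y c _ _ hc (substC_X_of_apply_eq_C D p u q hu hp hy (F.q_eq_zero_of_light hwy))
    F.fix hyS

end IsTailedLightFlow

end Lowest

end TailedLightFlow

end Literature.AlgebraicGeometry.Resolution.WeightedBlowup
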